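import Literature.NumberTheory.Weil1964.ArchVacuumSection
import Literature.NumberTheory.Weil1964.AdelicMetaplecticThetaMajorants
import Literature.NumberTheory.Weil1964.ArchFollandCocycleOne
import HarnessLib

/-!
# Weil's theta majorants from an archimedean implementer section (Weil 1964, n° 41; Folland 1989, §4.2)

Topic `NumberTheory/Weil1964`; namespace `Literature.NumberTheory.Weil1964`.  KERNEL MATHEMATICS ONLY: one
auxiliary definition (`carrierConj`), proved theorems, no `def … : Prop` record, no axiom, no proof hole.

**The junction between the adelic majorant theorem and the real implementer sections.**
`AdelicMetaplecticThetaMajorants.hasThetaMajorants_omega_comp` (Weil's Lemme 5 / Théorème 6 (1) of n° 41) says: for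
`T` invertible and a continuous homomorphism `s : H → Mp_ψ(W_𝔸)ᶜᵒⁿᵗ`, the family `h ↦ ω_ψ(s h)` on `𝒮(𝔸_Fⁿ)`
`HasThetaMajorants` as soon as one is GIVEN an auxiliary archimedean family
`W_∞ : H → End 𝓢(F_∞ⁿ)` with (w0) `W_∞(h) ≠ 0`, (w1) strong continuity, (w2) `archModTrans`-covariance over
`π(s h)`.  This file manufactures `W_∞` from data living on Folland's carrier `𝓢(ℝ^σ)`:

* §1 `carrierConj e A := (e^*)⁻¹ ∘ A ∘ e^*` pulls an operator `A` of `𝓢(ℝ^σ)` back to `𝓢(F_∞ⁿ)` along a real frame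
  `e : F_∞ⁿ ≃L[ℝ] ℝ^σ` (`SchwartzCarrierTransport.schwartzTransport`); it carries implementers of a phase-space map
  `φ` for `rhoS` to implementers of `φ` for `rhoSD e` (`carrierConj_rhoSD`), non-vanishing and strong continuity.
* §2 **`hasThetaMajorants_omega_comp_of_section`**: if `N : H → End 𝓢(ℝ^σ)` is nowhere zero, strongly continuous,
  and `N h` implements the Folland-coordinate phase map `archPhaseMap T e (π(s h))` of `ArchFollandCoordinates`
  (`N h ∘ ρ(p,q) = ρ(archPhaseMap … (p,q)) ∘ N h`), then `h ↦ ω_ψ(s h)` `HasThetaMajorants`.  The passage from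
  `ρ`-covariance in Folland coordinates to (w2) is `ArchFollandCocycleOne.arch_implements_of_covariant_rhoSD_clm`
  (the Folland cocycle of the archimedean Schrödinger factor is trivial).
* §3 **`hasThetaMajorants_omega_comp_of_kakData`**: the section is supplied by the CANONICAL VACUUM-NORMALISED
  IMPLEMENTER SECTION `vacSection γ` of `ArchVacuumSection` along any continuous map `ϖ : H → G` into a monoid with
  `KAK` implementer data (`KAKImplementerData γ κ a W_K W_A`: (w0) `vacSection_ne_zero`, (w1)
  `continuous_apply_vacSection`, (w2) `isImplementerS_vacSection`), under the single DICTIONARY hypothesis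
  `archPhaseMap T e (π(s h)) = γ (ϖ h)` identifying the archimedean action of `π(s h)` in the frame `e` with the
  real phase-space action `γ`.  Instances of the `KAK` data: `KonnoKonno2007.JunctionVacuumSection` (real unitary
  dual pairs of real rank one).

No archimedean splitting of the metaplectic cover, no cocycle and no vacuum-character datum is used: `vacSection` is
not a homomorphism and need not be one for Weil's majorants.

## References

* [Weil1964] A. Weil, *Sur certains groupes d'opérateurs unitaires*, Acta Math. 111 (1964) 143–211: Chap. III
  n° 41, Lemme 5 p. 192 and Théorème 6 (1) p. 193 (doi:10.1007/BF02391012).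
* [Folland1989] G. B. Folland, *Harmonic Analysis in Phase Space*, Annals of Mathematics Studies 122, Princeton
  University Press, 1989: §1.3 (1.25) (change of carrier), §4.2 (4.23)–(4.24) p. 156 (implementers of a symplectic
  map are unique up to a unimodular scalar) (doi:10.1515/9781400882427).

## Provenance

LEAN-IN-TREE rule (2026-08-18), pub-hodgecm model-construction sub-cell, lane mc-weil-2 gen 4 (node W2-wm.maj,
junction J, generic part).
-/

noncomputable section

open MeasureTheory Complex SchwartzMap
open scoped InnerProductSpace ComplexConjugate Real Matrix Classical
open NumberField NumberField.mixedEmbedding IsDedekindDomain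

namespace Literature.NumberTheory.Weil1964

open Literature.Analysis.SegalBargmann Literature.RepresentationTheory.HeisenbergGroup
open Literature.NumberTheory.Automorphic

variable {σ : Type*} [Fintype σ] [DecidableEq σ]
variable {D : Type*} [NormedAddCommGroup D] [NormedSpace ℝ D]

local notation "SR" σ => SchwartzMap (σ → ℝ) ℂ
local notation "SD" D => SchwartzMap D ℂ

/-! ## §1 Pull-back of Schwartz operators along a change of carrier -/

section Carrier

/-- **`carrierConj e A := (e^*)⁻¹ ∘ A ∘ e^*`**: the operator `A` of `𝓢(ℝ^σ)` pulled back to `𝓢(D)` along the frame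
`e : D ≃L[ℝ] ℝ^σ` (`e^* = schwartzTransport e : f ↦ f ∘ e⁻¹`). [cite: Folland1989, §1.3 (1.25)] -/
def carrierConj (e : D ≃L[ℝ] (σ → ℝ)) (A : (SR σ) →L[ℂ] SR σ) : (SD D) →L[ℂ] SD D :=
  ((schwartzTransport e).symm : (SR σ) →L[ℂ] SD D).comp (A.comp (schwartzTransport e : (SD D) →L[ℂ] SR σ))

omit [DecidableEq σ] in
/-- Unfolding. [folklore] -/
@[simp] theorem carrierConj_apply (e : D ≃L[ℝ] (σ → ℝ)) (A : (SR σ) →L[ℂ] SR σ) (Φ : SD D) :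
    carrierConj e A Φ = (schwartzTransport e).symm (A (schwartzTransport e Φ)) := rfl

omit [DecidableEq σ] in
/-- `e^* (carrierConj e A Φ) = A (e^* Φ)`. [folklore] -/
theorem schwartzTransport_carrierConj (e : D ≃L[ℝ] (σ → ℝ)) (A : (SR σ) →L[ℂ] SR σ) (Φ : SD D) :
    schwartzTransport e (carrierConj e A Φ) = A (schwartzTransport e Φ) :=
  (schwartzTransport e).apply_symm_apply _

omit [DecidableEq σ] in
/-- **Implementers transport**: if `A ∘ ρ(p,q) = ρ(φ(p,q)) ∘ A` on `𝓢(ℝ^σ)`, then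
`carrierConj e A ∘ ρ_D(p,q) = ρ_D(φ(p,q)) ∘ carrierConj e A` for the Heisenberg operators `ρ_D = rhoSD e` of `𝓢(D)`.
[cite: Folland1989, §1.3 (1.25)] -/
theorem carrierConj_rhoSD (e : D ≃L[ℝ] (σ → ℝ)) {φ : PhaseMap σ} {A : (SR σ) →L[ℂ] SR σ}
    (hA : ∀ (p q : σ → ℝ) (f : SR σ), A (rhoS p q f) = rhoS (φ (p, q)).1 (φ (p, q)).2 (A f))
    (p q : σ → ℝ) (Φ : SD D) :
    carrierConj e A (rhoSD e p q Φ) = rhoSD e (φ (p, q)).1 (φ (p, q)).2 (carrierConj e A Φ) := by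
  rw [carrierConj_apply, carrierConj_apply, schwartzTransport_rhoSD, hA, schwartzTransport_symm_rhoS]

omit [DecidableEq σ] in
/-- `carrierConj e A ≠ 0` when `A ≠ 0`. [folklore] -/
theorem carrierConj_ne_zero (e : D ≃L[ℝ] (σ → ℝ)) {A : (SR σ) →L[ℂ] SR σ} (hA : A ≠ 0) : carrierConj e A ≠ 0 := by
  intro h0
  apply hA
  refine ContinuousLinearMap.ext fun f => ?_
  have h1 := congrArg (fun B : (SD D) →L[ℂ] SD D => schwartzTransport e (B ((schwartzTransport e).symm f))) h0
  simpa using h1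

omit [DecidableEq σ] in
/-- **Strong continuity transports**: if every orbit map `x ↦ N x f` is continuous into `𝓢(ℝ^σ)`, so is every orbit
map `x ↦ carrierConj e (N x) Φ` into `𝓢(D)`. [folklore] -/
theorem continuous_carrierConj_apply {X : Type*} [TopologicalSpace X] (e : D ≃L[ℝ] (σ → ℝ))
    {N : X → ((SR σ) →L[ℂ] SR σ)} (hN : ∀ f : SR σ, Continuous fun x => N x f) (Φ : SD D) :
    Continuous fun x => carrierConj e (N x) Φ := by
  simp only [carrierConj_apply]
  exact (schwartzTransport e).symm.continuous.comp (hN (schwartzTransport e Φ))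

end Carrier

/-! ## §2 Theta majorants from an archimedean implementer section in Folland coordinates -/

section Majorants

variable {F : Type} [Field F] [NumberField F] {n : ℕ} {T : Matrix (Fin n) (Fin n) (AdeleRing (𝓞 F) F)}
  {H : Type*} [Group H] [TopologicalSpace H] [IsTopologicalGroup H]

omit [DecidableEq σ] in
/-- **Weil's theta majorants from an archimedean implementer section.**  Let `T` be invertible with invertible
archimedean part, `s : H → Mp_ψ(W_𝔸)ᶜᵒⁿᵗ` a continuous homomorphism, `e : F_∞ⁿ ≃ ℝ^σ` a real frame, and
`N : H → End 𝓢(ℝ^σ)` a family with (n0) `N h ≠ 0`, (n1) every orbit map `h ↦ N h f` continuous, (n2) `N h`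
implements the Folland-coordinate phase map of `π(s h)`: `N h ∘ ρ(p,q) = ρ(archPhaseMap T e (π(s h)) (p,q)) ∘ N h`.
Then `h ↦ ω_ψ(s h)` on `𝒮(𝔸_Fⁿ)` `HasThetaMajorants`.  (`W_∞ := carrierConj e ∘ N`; (w2) by the triviality of the
Folland cocycle, `arch_implements_of_covariant_rhoSD_clm`.)
[cite: Weil1964, Chap. III n° 41 Lemme 5 p. 192, Théorème 6 (1) p. 193; Folland1989, §4.2 (4.24) p. 156] -/
theorem hasThetaMajorants_omega_comp_of_section (hT : IsUnit T) (s : H →* adelicMpCont F (Fin n) T)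
    (hs : Continuous s) (e : (Fin n → mixedSpace F) ≃L[ℝ] (σ → ℝ)) (hT' : IsUnit (archMat F (Fin n) T))
    (N : H → ((SR σ) →L[ℂ] SR σ)) (n0 : ∀ h, N h ≠ 0) (n1 : ∀ f : SR σ, Continuous fun h => N h f)
    (n2 : ∀ (h : H) (p q : σ → ℝ) (f : SR σ), N h (rhoS p q f) =
      rhoS (archPhaseMap T e hT' (adelicMpCont.proj F (Fin n) T (s h)) (p, q)).1
        (archPhaseMap T e hT' (adelicMpCont.proj F (Fin n) T (s h)) (p, q)).2 (N h f)) :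
    HasThetaMajorants (F := F) fun h Φ => adelicMpCont.omega F (Fin n) T (s h) Φ :=
  hasThetaMajorants_omega_comp hT s hs (fun h => carrierConj e (N h)) (fun h => carrierConj_ne_zero e (n0 h))
    (fun Φ => continuous_carrierConj_apply e n1 Φ)
    (fun h a w Φ => arch_implements_of_covariant_rhoSD_clm T e hT' (adelicMpCont.proj F (Fin n) T (s h))
      (carrierConj e (N h)) (fun p q Ψ => carrierConj_rhoSD e (n2 h) p q Ψ) a w Φ)

variable {G : Type*} [Monoid G] [TopologicalSpace G] {K : Type*} [TopologicalSpace K] {P : Type*} [TopologicalSpace P]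

omit [DecidableEq σ] [Monoid G] in
/-- **… along a continuous map into a group carrying the section.**  Same, with the section `N₀ : G → End 𝓢(ℝ^σ)`
implementing a phase-space action `γ : G → PhaseMap σ`, composed with a continuous `ϖ : H → G`, under the dictionary
hypothesis `archPhaseMap T e (π(s h)) = γ (ϖ h)`. [cite: Weil1964, Chap. III n° 41 Théorème 6 (1) p. 193] -/
theorem hasThetaMajorants_omega_comp_of_section_comp (hT : IsUnit T) (s : H →* adelicMpCont F (Fin n) T)
    (hs : Continuous s) (e : (Fin n → mixedSpace F) ≃L[ℝ] (σ → ℝ)) (hT' : IsUnit (archMat F (Fin n) T))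
    {γ : G → PhaseMap σ} (N₀ : G → ((SR σ) →L[ℂ] SR σ)) (n0 : ∀ g, N₀ g ≠ 0)
    (n1 : ∀ f : SR σ, Continuous fun g => N₀ g f) (n2 : ∀ g, IsImplementerS (γ g) (N₀ g))
    (ϖ : H → G) (hϖ : Continuous ϖ)
    (hγ : ∀ h, archPhaseMap T e hT' (adelicMpCont.proj F (Fin n) T (s h)) = γ (ϖ h)) :
    HasThetaMajorants (F := F) fun h Φ => adelicMpCont.omega F (Fin n) T (s h) Φ :=
  hasThetaMajorants_omega_comp_of_section hT s hs e hT' (fun h => N₀ (ϖ h)) (fun h => n0 (ϖ h))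
    (fun f => (n1 f).comp hϖ) fun h p q f => by
      rw [hγ h]
      exact (n2 (ϖ h)).1 p q f

/-! ## §3 The canonical vacuum-normalised section supplies the archimedean family -/

/-- **Weil's theta majorants from `KAK` implementer data.**  For `T` invertible with invertible archimedean part,
a continuous homomorphism `s : H → Mp_ψ(W_𝔸)ᶜᵒⁿᵗ`, a real frame `e`, a phase-space action `γ : G → PhaseMap σ` with
`KAK` implementer data, and a continuous `ϖ : H → G` such that the archimedean action of `π(s h)` in the frame `e`
IS `γ (ϖ h)`: the family `h ↦ ω_ψ(s h)` on `𝒮(𝔸_Fⁿ)` `HasThetaMajorants` — with the archimedean family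
`W_∞(h) := carrierConj e (vacSection γ (ϖ h))` ((w0) `vacSection_ne_zero`, (w1) `continuous_apply_vacSection`,
(w2) `isImplementerS_vacSection`). [cite: Weil1964, Chap. III n° 41 Lemme 5 p. 192, Théorème 6 (1) p. 193;
Folland1989, §4.2 (4.23)–(4.24) p. 156] -/
theorem hasThetaMajorants_omega_comp_of_kakData (hT : IsUnit T) (s : H →* adelicMpCont F (Fin n) T)
    (hs : Continuous s) (e : (Fin n → mixedSpace F) ≃L[ℝ] (σ → ℝ)) (hT' : IsUnit (archMat F (Fin n) T))
    {γ : G → PhaseMap σ} {κ : K → G} {a : P → G} {WK : K → ((SR σ) →L[ℂ] SR σ)}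
    {WA : P → ((SR σ) →L[ℂ] SR σ)} (Dk : KAKImplementerData γ κ a WK WA) (ϖ : H → G) (hϖ : Continuous ϖ)
    (hγ : ∀ h, archPhaseMap T e hT' (adelicMpCont.proj F (Fin n) T (s h)) = γ (ϖ h)) :
    HasThetaMajorants (F := F) fun h Φ => adelicMpCont.omega F (Fin n) T (s h) Φ :=
  hasThetaMajorants_omega_comp_of_section_comp hT s hs e hT' (vacSection γ) Dk.vacSection_ne_zero
    Dk.continuous_apply_vacSection Dk.isImplementerS_vacSection ϖ hϖ hγ

/-- The archimedean family of §3 satisfies (w2) of `hasThetaMajorants_omega_comp` LITERALLY (for consumers who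
call Weil's theorem themselves). [cite: Folland1989, §4.2 (4.24) p. 156] -/
theorem carrierConj_vacSection_archModTrans (e : (Fin n → mixedSpace F) ≃L[ℝ] (σ → ℝ))
    (hT' : IsUnit (archMat F (Fin n) T)) {γ : G → PhaseMap σ} {κ : K → G} {a : P → G}
    {WK : K → ((SR σ) →L[ℂ] SR σ)} {WA : P → ((SR σ) →L[ℂ] SR σ)} (Dk : KAKImplementerData γ κ a WK WA)
    {g : symplecticGroup (polar (adelicForm F (Fin n) T))} {x : G} (hγ : archPhaseMap T e hT' g = γ x)
    (a' w : Fin n → mixedSpace F) (Φ : 𝓢((Fin n → mixedSpace F), ℂ)) :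
    carrierConj e (vacSection γ x) (archModTrans F (Fin n) T a' w Φ) =
      weilPhase T g (a', w) • archModTrans F (Fin n) T (archAct T g (a', w)).1 (archAct T g (a', w)).2
        (carrierConj e (vacSection γ x) Φ) :=
  arch_implements_of_covariant_rhoSD_clm T e hT' g (carrierConj e (vacSection γ x))
    (fun p q Ψ => carrierConj_rhoSD e (φ := archPhaseMap T e hT' g)
      (fun p q f => by rw [hγ]; exact (Dk.isImplementerS_vacSection x).1 p q f) p q Ψ) a' w Φ

omit [Group H] [IsTopologicalGroup H] in
/-- … (w1) literally. [cite: Folland1989, §4.2 p. 156] -/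
theorem continuous_carrierConj_vacSection {γ : G → PhaseMap σ} {κ : K → G} {a : P → G}
    {WK : K → ((SR σ) →L[ℂ] SR σ)} {WA : P → ((SR σ) →L[ℂ] SR σ)} (Dk : KAKImplementerData γ κ a WK WA)
    (e : D ≃L[ℝ] (σ → ℝ)) {ϖ : H → G} (hϖ : Continuous ϖ) (Φ : SD D) :
    Continuous fun h => carrierConj e (vacSection γ (ϖ h)) Φ :=
  continuous_carrierConj_apply e (N := fun h => vacSection γ (ϖ h))
    (fun f => (Dk.continuous_apply_vacSection f).comp hϖ) Φ

/-- … (w0) literally. [cite: Folland1989, §4.2 (4.23) p. 156] -/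
theorem carrierConj_vacSection_ne_zero {γ : G → PhaseMap σ} {κ : K → G} {a : P → G}
    {WK : K → ((SR σ) →L[ℂ] SR σ)} {WA : P → ((SR σ) →L[ℂ] SR σ)} (Dk : KAKImplementerData γ κ a WK WA)
    (e : D ≃L[ℝ] (σ → ℝ)) (x : G) : carrierConj e (vacSection γ x) ≠ 0 :=
  carrierConj_ne_zero e (Dk.vacSection_ne_zero x)

end Majorants

/-! ## §4 Helpers for the dictionary hypothesis `hγ`

Both sides of `hγ` are multiplicative: `archPhaseMap T e (g g') = archPhaseMap T e g ∘ archPhaseMap T e g'`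
(`archPhaseMap_mul`), and a phase-space action agreeing with `γ` on the images of `κ` and `a` agrees with `γ` on all of
`G` (`KAKImplementerData.eq_of_eq_on_generators`, by the surjectivity of the `KAK` word map) — so an instance checks
`hγ` on the compact generators and on the `A`-part only. -/

section Dictionary

variable {F : Type} [Field F] [NumberField F] {ι : Type} [Fintype ι] [DecidableEq ι]
  (T : Matrix ι ι (AdeleRing (𝓞 F) F))

/-- `archAct` is an action: `archAct (g g') = archAct g ∘ archAct g'`. [folklore] -/
theorem archAct_mul (g g' : symplecticGroup (polar (adelicForm F ι T)))
    (aw : (ι → mixedSpace F) × (ι → mixedSpace F)) : archAct T (g * g') aw = archAct T g (archAct T g' aw) := by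
  obtain ⟨a, w⟩ := aw
  have h := apply_archVec_pair T (g * g') a w
  rw [Subgroup.coe_mul, LinearEquiv.mul_apply, apply_archVec_pair T g' a w, apply_archVec_pair T g] at h
  have h1 := congrArg (fun p : (ι → AdeleRing (𝓞 F) F) × (ι → AdeleRing (𝓞 F) F) => (piArch F ι p.1, piArch F ι p.2)) h
  simpa only [piArch_archVec, Prod.mk.eta] using h1.symm

omit [DecidableEq σ] in
/-- … and so is its Folland-coordinate form: `archPhaseMap T e (g g') = archPhaseMap T e g ∘ archPhaseMap T e g'`.
[folklore] -/
theorem archPhaseMap_mul (e : (ι → mixedSpace F) ≃L[ℝ] (σ → ℝ)) (hT : IsUnit (archMat F ι T))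
    (g g' : symplecticGroup (polar (adelicForm F ι T))) (pq : (σ → ℝ) × (σ → ℝ)) :
    archPhaseMap T e hT (g * g') pq = archPhaseMap T e hT g (archPhaseMap T e hT g' pq) := by
  obtain ⟨aw, rfl⟩ := (archFolland_bijective (T := T) e hT).2 pq
  rw [archPhaseMap_archFolland, archPhaseMap_archFolland, archPhaseMap_archFolland, archAct_mul]

end Dictionary

section Generators

variable {G : Type*} [Monoid G] [TopologicalSpace G] {K : Type*} [TopologicalSpace K] {P : Type*} [TopologicalSpace P]

omit [Fintype σ] [DecidableEq σ] [TopologicalSpace G] [TopologicalSpace K] [TopologicalSpace P] in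
/-- **A multiplicative phase-space action is determined on `KAK` generators**: if `γ'` is compatible with
multiplication and agrees with `γ` on `κ(K)` and on `a(P)`, and the word map `(k₁, t, k₂) ↦ κ k₁ · a t · κ k₂` is onto,
then `γ' = γ`. [cite: Knapp2002, Thm 7.39] -/
theorem eq_of_eq_on_kak_generators {γ γ' : G → PhaseMap σ} {κ : K → G} {a : P → G}
    (hγ : ∀ g g' pq, γ (g * g') pq = γ g (γ g' pq)) (hγ' : ∀ g g' pq, γ' (g * g') pq = γ' g (γ' g' pq))
    (hsurj : Function.Surjective fun p : K × P × K => κ p.1 * a p.2.1 * κ p.2.2)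
    (hK : ∀ k, γ' (κ k) = γ (κ k)) (hA : ∀ t, γ' (a t) = γ (a t)) (g : G) : γ' g = γ g := by
  obtain ⟨⟨k₁, t, k₂⟩, rfl⟩ := hsurj g
  funext pq
  simp only [hγ, hγ', hK, hA]

/-- The same for `KAK` implementer data (`map_mul` and `surjective` are fields). [cite: Knapp2002, Thm 7.39] -/
theorem KAKImplementerData.eq_of_eq_on_generators {γ γ' : G → PhaseMap σ} {κ : K → G} {a : P → G}
    {WK : K → ((SR σ) →L[ℂ] SR σ)} {WA : P → ((SR σ) →L[ℂ] SR σ)} (Dk : KAKImplementerData γ κ a WK WA)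
    (hγ' : ∀ g g' pq, γ' (g * g') pq = γ' g (γ' g' pq)) (hK : ∀ k, γ' (κ k) = γ (κ k))
    (hA : ∀ t, γ' (a t) = γ (a t)) (g : G) : γ' g = γ g :=
  eq_of_eq_on_kak_generators Dk.map_mul hγ' Dk.surjective hK hA g

end Generators

end Literature.NumberTheory.Weil1964

end
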